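import Mathlib
import Literature.Analysis.FluidPDE.Tao2016AveragedNS.ShiftSetCascadeFlows
import Summits.NavierStokesRegularity.NavierStokesRegularity.Theorems.TaoLadderRungTwoFlatCertificateGlueCheckerFieldOn
import HarnessLib

/-!
# Certificate glue on a shift set `𝕊`, XXIV-c: THE CHECKER'S COEFFICIENT BOXES — relative-precision rational enclosures,
  a checked square-root enclosure, the clock boxes `(1+ε₀)^{5j/2}` and the computable coefficient-box builder `coefBoxOf`
  with its soundness `coefBoxOK_coefBoxOf` (helper for items stmt-NavierStokesRegularity-22987 `FlatGapCertificatesV2`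
  (crux K_A♭ of route TaoLadderRungTwoFlat) and stmt-24295 K_A₂(64); cell harvest/h2-tao-ladder, p1 g15; CHECKER-SPEC-v3 §3 (i))

Glue XXIV's twin `pqBox` takes coefficient boxes `coefB` with the hypothesis `CoefBoxOK` (each box contains
`α i₁ i₂ i μ · (1+ε₀)^{5(k−μ₃)/2} · ω i₁ a ω i₂ b / ω i k`). This file DISCHARGES that hypothesis computably for rational data
(`α = ↑∘αq`, `ω = ↑∘ωq`, `ε₀ = ↑q`): the rational factor by `ofRatRel` (outward rounding at RELATIVE precision `prec` — the
coefficients span dozens of binades once the per-component weights are folded in; pub-ns-dss's `ofRat` is absolute), the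
clock by `clockBox` from two CHECKED square-root boxes `S₊ ∋ √(1+q)`, `S₋ ∋ √(1/(1+q))` (`sqrtCheck`: `0 ≤ lo`, `0 ≤ hi`,
`lo² ≤ q' ≤ hi²` tested in exact dyadic arithmetic against a relative enclosure of `q'`) and rounded powers
(`(1+q)^{5j/2} = (√(1+q))^{5j}` for `j ≥ 0`, `= (√(1/(1+q)))^{5|j|}` for `j < 0`).

HONEST FRAMING: Tao-type MODEL lattices (Tao 2016 §4/§6 vocabulary, shift-set parametrised); interval-arithmetic soundness
lemmas — no certificate data, nothing certified, no stub closed, nothing about the Navier–Stokes equations.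
-/

-- the sub-problem namespace repeats the summit name by design (D-0017)
set_option linter.dupNamespace false

namespace Summit.NavierStokesRegularity.NavierStokesRegularity.Theorems

open Set Literature.Analysis.FluidPDE Literature.Analysis.FluidPDE.TaoCascade
open Summit.NavierStokesRegularity.NavierStokesRegularity.Theorems.TaylorModelCert

namespace CertificateGlueOn

variable {m : ℕ} {Kb Ka : ℤ}

/-! ### Relative-precision rational enclosure -/

/-- A binary exponent for `q` at relative precision `prec` (any value is SOUND; this one keeps ≈ `prec` mantissa bits). [folklore] -/
def relExp (prec : ℕ) (q : ℚ) : ℤ := (Nat.log2 q.num.natAbs : ℤ) - (Nat.log2 q.den : ℤ) - prec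

/-- Outward-rounded enclosure of a rational at RELATIVE precision: `[⌊q·2^{−e}⌋, ⌈q·2^{−e}⌉]·2^e`, `e = relExp prec q`.
[folklore] -/
def ofRatRel (prec : ℕ) (q : ℚ) : IntervalD :=
  let e := relExp prec q
  ⟨⟨⌊q / (2 : ℚ) ^ e⌋, e⟩, ⟨⌈q / (2 : ℚ) ^ e⌉, e⟩⟩

/-- `q ∈ ofRatRel prec q`. [folklore] -/
theorem mem_ofRatRel (prec : ℕ) (q : ℚ) : IntervalD.mem (q : ℝ) (ofRatRel prec q) := by
  have h2 : (0 : ℝ) < (2 : ℝ) ^ relExp prec q := zpow_pos (by norm_num) _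
  have hq : ((q / (2 : ℚ) ^ relExp prec q : ℚ) : ℝ) = (q : ℝ) / (2 : ℝ) ^ relExp prec q := by push_cast; ring
  constructor
  · show ((⌊q / (2 : ℚ) ^ relExp prec q⌋ : ℤ) : ℝ) * (2 : ℝ) ^ relExp prec q ≤ q
    have h1 : ((⌊q / (2 : ℚ) ^ relExp prec q⌋ : ℤ) : ℝ) ≤ (q : ℝ) / (2 : ℝ) ^ relExp prec q := by
      rw [← hq]; exact_mod_cast Int.floor_le _
    calc _ ≤ (q : ℝ) / (2 : ℝ) ^ relExp prec q * (2 : ℝ) ^ relExp prec q :=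
          mul_le_mul_of_nonneg_right h1 h2.le
      _ = q := div_mul_cancel₀ _ h2.ne'
  · show (q : ℝ) ≤ ((⌈q / (2 : ℚ) ^ relExp prec q⌉ : ℤ) : ℝ) * (2 : ℝ) ^ relExp prec q
    have h1 : (q : ℝ) / (2 : ℝ) ^ relExp prec q ≤ ((⌈q / (2 : ℚ) ^ relExp prec q⌉ : ℤ) : ℝ) := by
      rw [← hq]; exact_mod_cast Int.le_ceil _
    calc (q : ℝ) = (q : ℝ) / (2 : ℝ) ^ relExp prec q * (2 : ℝ) ^ relExp prec q := (div_mul_cancel₀ _ h2.ne').symm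
      _ ≤ _ := mul_le_mul_of_nonneg_right h1 h2.le

/-! ### Checked square roots and the clock boxes -/

/-- **Square-root check**: `0 ≤ S.lo`, `0 ≤ S.hi`, `S.lo² ≤ q ≤ S.hi²` (exact dyadic squares against the relative enclosure of
`q` at precision `prec`). [folklore] -/
def sqrtCheck (prec : ℕ) (q : ℚ) (S : IntervalD) : Bool :=
  Dyad.ble (Dyad.ofInt 0) S.lo && Dyad.ble (Dyad.ofInt 0) S.hi &&
    Dyad.ble (Dyad.mul S.lo S.lo) (ofRatRel prec q).lo && Dyad.ble (ofRatRel prec q).hi (Dyad.mul S.hi S.hi)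

/-- A passed square-root check encloses `√q`. [folklore] -/
theorem mem_sqrt_of_sqrtCheck {prec : ℕ} {q : ℚ} {S : IntervalD} (h : sqrtCheck prec q S = true) :
    IntervalD.mem (Real.sqrt q) S := by
  simp only [sqrtCheck, Bool.and_eq_true, Dyad.ble_iff, Dyad.toReal_ofInt, Dyad.toReal_mul, Int.cast_zero] at h
  obtain ⟨⟨⟨hlo0, hhi0⟩, hlo⟩, hhi⟩ := h
  have hq := mem_ofRatRel prec q
  have hq0 : (0 : ℝ) ≤ q := by nlinarith [hq.1, hlo, mul_nonneg hlo0 hlo0]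
  constructor
  · exact (Real.le_sqrt hlo0 hq0).mpr (by nlinarith [hq.1, hlo])
  · exact Real.sqrt_le_iff.mpr ⟨hhi0, by nlinarith [hq.2, hhi]⟩

/-- The clock box `(1+ε₀)^{5j/2}`: `S₊^{5j}` for `j ≥ 0`, `S₋^{5|j|}` for `j < 0` (`S₊ ∋ √(1+ε₀)`, `S₋ ∋ √(1/(1+ε₀))`).
[cite: Tao2016AveragedNS, §4 (4.8) (the clock factor); cell certificate format, checker field] -/
def clockBox (prec : ℕ) (Sp Sm : IntervalD) (j : ℤ) : IntervalD :=
  if 0 ≤ j then IntervalD.powR prec Sp (5 * j).toNat else IntervalD.powR prec Sm (5 * (-j)).toNat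

/-- The clock box encloses the clock. [folklore] -/
theorem mem_clockBox (prec : ℕ) {ε₀ : ℝ} (hε : 0 < 1 + ε₀) {Sp Sm : IntervalD} (hp : IntervalD.mem (Real.sqrt (1 + ε₀)) Sp)
    (hm : IntervalD.mem (Real.sqrt (1 + ε₀)⁻¹) Sm) (j : ℤ) :
    IntervalD.mem ((1 + ε₀) ^ ((5 : ℝ) * j / 2)) (clockBox prec Sp Sm j) := by
  unfold clockBox
  split_ifs with hj
  · have hval : (1 + ε₀) ^ ((5 : ℝ) * j / 2) = Real.sqrt (1 + ε₀) ^ (5 * j).toNat := by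
      rw [Real.sqrt_eq_rpow, ← Real.rpow_natCast, ← Real.rpow_mul hε.le]
      congr 1
      have : (((5 * j).toNat : ℕ) : ℝ) = 5 * (j : ℝ) := by
        have h5 : 0 ≤ 5 * j := by omega
        rw [show (((5 * j).toNat : ℕ) : ℝ) = (((5 * j).toNat : ℤ) : ℝ) by norm_cast, Int.toNat_of_nonneg h5]
        push_cast; ring
      rw [this]; ring
    rw [hval]
    exact IntervalD.mem_powR prec hp _
  · push Not at hj
    have hval : (1 + ε₀) ^ ((5 : ℝ) * j / 2) = Real.sqrt (1 + ε₀)⁻¹ ^ (5 * (-j)).toNat := by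
      rw [Real.sqrt_eq_rpow, ← Real.rpow_natCast, ← Real.rpow_mul (inv_nonneg.mpr hε.le),
        Real.inv_rpow hε.le, ← Real.rpow_neg hε.le]
      congr 1
      have : (((5 * (-j)).toNat : ℕ) : ℝ) = -(5 * (j : ℝ)) := by
        have h5 : 0 ≤ 5 * (-j) := by omega
        rw [show (((5 * (-j)).toNat : ℕ) : ℝ) = (((5 * (-j)).toNat : ℤ) : ℝ) by norm_cast, Int.toNat_of_nonneg h5]
        push_cast; ring
      rw [this]; ring
    rw [hval]
    exact IntervalD.mem_powR prec hm _

/-! ### The coefficient-box builder -/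

/-- **Computable coefficient boxes** for rational data: `ofRatRel (αq · ωq i₁ a · ωq i₂ b / ωq i k) · clockBox (k − μ₃)`.
[cite: Tao2016AveragedNS, §4 (4.8); cell certificate format, checker field] -/
def coefBoxOf (prec : ℕ) (αq : Fin m → Fin m → Fin m → ℤ × ℤ × ℤ → ℚ) (ωq : Fin m → ℤ → ℚ) (Sp Sm : IntervalD)
    (i : Fin m) (k : ℤ) (i₁ i₂ : Fin m) (μ : ℤ × ℤ × ℤ) : IntervalD :=
  IntervalD.mulR prec
    (ofRatRel prec (αq i₁ i₂ i μ * (ωq i₁ (k - μ.2.2 + μ.1) * ωq i₂ (k - μ.2.2 + μ.2.1) / ωq i k)))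
    (clockBox prec Sp Sm (k - μ.2.2))

/-- **The built coefficient boxes are sound** (`CoefBoxOK` of glue XXIV) for `ε₀ = ↑q`, `α = ↑∘αq`, `ω = ↑∘ωq`, given the
two checked square roots. [cite: Tao2016AveragedNS, §4 (4.8); cell certificate format, checker field] -/
theorem coefBoxOK_coefBoxOf (prec : ℕ) {q : ℚ} (hq : 0 < 1 + (q : ℝ)) (αq : Fin m → Fin m → Fin m → ℤ × ℤ × ℤ → ℚ)
    (ωq : Fin m → ℤ → ℚ) {Sp Sm : IntervalD} (hSp : sqrtCheck prec (1 + q) Sp = true)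
    (hSm : sqrtCheck prec (1 / (1 + q)) Sm = true) (shifts : List (ℤ × ℤ × ℤ)) :
    CoefBoxOK shifts (q : ℝ) (fun i₁ i₂ i μ => (αq i₁ i₂ i μ : ℝ)) Kb Ka (fun i k => (ωq i k : ℝ))
      (coefBoxOf prec αq ωq Sp Sm) := by
  intro i k i₁ i₂ μ _ _ _
  have hp : IntervalD.mem (Real.sqrt (1 + (q : ℝ))) Sp := by
    have := mem_sqrt_of_sqrtCheck hSp; push_cast at this; exact this
  have hm : IntervalD.mem (Real.sqrt (1 + (q : ℝ))⁻¹) Sm := by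
    have := mem_sqrt_of_sqrtCheck hSm; push_cast at this; rwa [one_div] at this
  have hval : pcoef (q : ℝ) (fun i₁ i₂ i μ => (αq i₁ i₂ i μ : ℝ)) (fun i k => (ωq i k : ℝ)) i k i₁ i₂ μ =
      ((αq i₁ i₂ i μ * (ωq i₁ (k - μ.2.2 + μ.1) * ωq i₂ (k - μ.2.2 + μ.2.1) / ωq i k) : ℚ) : ℝ) *
        (1 + (q : ℝ)) ^ ((5 : ℝ) * ((k - μ.2.2 : ℤ) : ℝ) / 2) := by
    unfold pcoef; push_cast; ring
  unfold coefBoxOf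
  rw [hval]
  exact IntervalD.mem_mulR prec (mem_ofRatRel prec _) (mem_clockBox prec hq hp hm (k - μ.2.2))

end CertificateGlueOn

end Summit.NavierStokesRegularity.NavierStokesRegularity.Theorems
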